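import Summits.QuantumFields.BalabanUV.Beta.GAN24.BlockFluxRegion

/-!
# `BalabanUV.Beta.GAN24.BlockFluxMass` — binder row G-an2-4 ∕ (CONV-C), CT-W (route «WC-TL» ∕ (Q-R) «QR-LL», located scalar K-LL-4′ ∕ the (DIV) display of RULING R-gan24p1-g29-2):
# **THE FLUX RECURSION IN TOTAL-MASS (ℓ¹) CURRENCY — THE KERNEL-ONLY MAP `V ↦ c • mmRead N (K ∘ V ∘ K)` HAS ℓ¹ → ℓ¹ GAIN `|c|·|Fib d|²·C²·Z_δ²`, WITH NO
# REFINEMENT MULTIPLICITY**: every finite partial sum of the output's entries over pairs of coarse points is bounded by that constant times the input's total entry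
# mass (each fine bond counted ONCE) — the third currency of the RULING's per-level factor (next to `BlockFluxRegion` §3 and `BlockFluxLocal` ∕ leaf-01's
# `BoundaryFluxFaceCount`): RULING R-g29-2 (1)'s «TOTAL flux with the d-free contracting factor» as a typed bound; sequel of `GAN24/BlockFluxRegion`; leaf prover
# `b2b-balaban-gan24-formalise-leaf-03`, gen 62, programme «FLUX-REC» PART 5; module name PROVISIONAL — the row owner gan24-p1 may rename ∕ re-home it)

NOT IN PRINT; OUR BOOKKEEPING.  HONEST FRAMING (cell contract, verbatim): «discharging `BetaPertH` makes Bałaban's UV stability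
UNCONDITIONAL — a real constructive-QFT result; it is NOT the continuum limit and NOT the Clay problem.»  HONEST DEPENDENCY (verbatim):
«continuum YM on T⁴ ⇐ BetaPertH ∧ nine spine estimates (0/9 proved); BetaPertH ⇐ (D1) ∧ (D4) ∧ CAP+tail; G-an2-4 gates asym, D1 and
NE2/3/4.»

WHAT ([folklore] `tsum` bookkeeping — `tsum_of_norm_bounded`, `Summable.tsum_finsetSum ∕ sum_le_tsum ∕ tsum_le_tsum`, `summable_exp_shift ∕ tsum_exp_shift`; a decaying
`K` (`Decays K C δ`, `δ > 0`), `N ≥ 1`, and an input `V` dominated entrywise by a MASS FUNCTION `μ y w ≥ 0` with summable columns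
and summable column totals, `M₁ := Σ'_w Σ'_y μ y w`; generic `d`; 0 `def`, 0 cite, 0 `def … : Prop`, 0 sorry):
* §1 `finsetSum_exp_dilate_le_Zl` (`Σ_{z∈F} e^{−δ‖w−N•z‖₁} ≤ Z_δ`, finite `F`), `abs_comp_le_mass`, `abs_sandwich_le_mass` (one output entry), summability bricks.
* §2 **`finsetSum_abs_sandwich_le_mass`** — `Σ_{x′∈Fx} Σ_{z′∈Fz} |(K∘V∘K)(N•x′)(N•z′) a b| ≤ |Fib d|²·C²·Z_δ²·M₁` uniformly in the finite sets;
  **`finsetSum_abs_smul_mmRead_sandwich_le_mass`** — the flux map `c • mmRead N (K∘V∘K)` (× `|c|`; off-`ff` blocks `0`).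
* §3 **`finsetSum_abs_regionSum_divV_e3OfK_le_mass`** — PART 1's identity ⨾ §2: every finite partial sum over coarse pairs of the pushed letter's flux entries through `T`
  is `≤ |c_H|·|Fib d|²·C²·Z_δ²·M₁` when the input flux through `U_N(T)` has total mass `M₁` — the bare kernel-only scalar, each input bond counted ONCE.
* (the COARSE-WEIGHT form — legs windowed by coarse-summable weights, NO dilation loss; leaf-01 g67 W-2's normal form — is `BlockFluxMassTower` §0.)

LOCATED CAVEATS (leaf-01 g67 R-1 ∕ W-2, adopted): (i) total mass is NOT what the END's `BiLoc` rows read (PART 3 ∕ leaf-01's count do that); this is the currency in which the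
tower CONTRACTS level-free whenever the displayed scalar is `< 1`; (ii) §1–§3 take the legs in FINE-lattice distance and bound the dilated sums by the full `Z_δ` — for the END's
comb kernel (block-scale rate `δ ≍ κ₀∕Lc`) that loses `Lc^{d+1}` per leg against the block-label count, so in `unitS` currency §2–§3 read `≍ Lc^{2d}` while R-1 (iii)'s VALUE
`A²·Z_{κ₀}²·Lc^{−2}` (d-free, contracting) comes out of the coarse-weight form (`BlockFluxMassTower` §0, `finsetSum_abs_sandwich_le_mass_weight`) with (N1)'s
`h = A·(Lc^{d+2})⁻¹` and the END weight — inserted by the reader, asserted by no theorem here.  Decides nothing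
about (Q-R) ∕ (DIV) ∕ (DL) ∕ K-LL-4′; NOTHING of (LT) ∕ (LAY) ∕ (S) ∕ «T2Shape» ∕ «T2Drift» ∕ (hW, hWall) discharged; 0 wall binders; NEVER «G-an2-4 closed» as (CONV-C); NOT D1, NOT
`BetaPertH`, NOT continuum, NOT Clay; not in print — our bookkeeping.  Unit `b2b-balaban-gan24-formalise-leaf-03` (gen 62), 2026-08-22.
-/

noncomputable section

open Finset
open scoped BigOperators
open Literature.MathematicalPhysics.QuantumFieldTheory
open Literature.MathematicalPhysics.QuantumFieldTheory.Balaban1983to89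
open Literature.MathematicalPhysics.QuantumFieldTheory.Balaban1983to89.Beta
open B12Sec2to5 (l1 l1_nonneg)
open B6BondElimination (unitVec)
open ExpKernelCalculus (MKer Site Decays comp Zl Zl_nonneg summable_exp_shift summable_exp_shift' tsum_exp_shift tsum_exp_shift')
open OneStepResolventKernel (Fib)
open OneStepKernelFamily (colH)
open BalabanStepJetsSucc (mmRead mmRead_inl_inl)
open KernelWard (divV Bdd)
open AffineAveraging (box toSite)
open Summit.QuantumFields.BalabanUV.Beta.KernelWardRelative (gaugeWt)
open Summit.QuantumFields.BalabanUV.Beta.SpineRooted (e3OfK)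
open Summit.QuantumFields.BalabanUV.Beta.GAN24.BlockFluxRegion (regionSum_divV_e3OfK)

namespace Summit.QuantumFields.BalabanUV.Beta.GAN24.BlockFluxMass

variable {d N : ℕ}

/-! ## §1 Bricks: dilated exponential sums; the composition against a mass function -/

/-- [folklore] `Σ_{z ∈ F} e^{−δ‖w − N•z‖₁} ≤ Z_δ` for every finite `F` (`N ≥ 1`: the dilated points are distinct fine points; a partial sum of `tsum_exp_shift`). -/
theorem finsetSum_exp_dilate_le_Zl {δ : ℝ} (hδ : 0 < δ) (hN : 1 ≤ N) (w : Site (d + 1)) (F : Finset (Site (d + 1))) :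
    ∑ z ∈ F, Real.exp (-δ * l1 (w - (N : ℤ) • z)) ≤ Zl (d + 1) δ := by
  classical
  have hinj : Set.InjOn (fun z : Site (d + 1) => (N : ℤ) • z) F := by
    intro z _ z' _ h
    have hN0 : (N : ℤ) ≠ 0 := by exact_mod_cast (Nat.one_le_iff_ne_zero.1 hN)
    exact smul_right_injective (Site (d + 1)) hN0 h
  rw [← Finset.sum_image (f := fun u => Real.exp (-δ * l1 (w - u))) hinj, ← tsum_exp_shift (c := δ) w]
  exact (summable_exp_shift hδ w).sum_le_tsum _ (fun u _ => (Real.exp_pos _).le)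

section Mass

variable {K V : MKer (d + 1) (Fib d)} {C δ : ℝ} {μ : Site (d + 1) → Site (d + 1) → ℝ}

/-- [folklore] `y ↦ e^{−δ‖X−y‖₁}·μ y w` is summable (comparison with the column). -/
theorem summable_exp_mul_mass {δ : ℝ} (hδ : 0 ≤ δ) (hμ0 : ∀ y w, 0 ≤ μ y w) (hμy : ∀ w, Summable fun y => μ y w)
    (X w : Site (d + 1)) : Summable fun y => Real.exp (-δ * l1 (X - y)) * μ y w := by
  refine Summable.of_nonneg_of_le (fun y => mul_nonneg (Real.exp_pos _).le (hμ0 y w)) (fun y => ?_) (hμy w)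
  have h1 : Real.exp (-δ * l1 (X - y)) ≤ 1 := by
    rw [Real.exp_le_one_iff]; nlinarith [l1_nonneg (X - y)]
  exact (mul_le_of_le_one_left (hμ0 y w) h1)

/-- [folklore] The decay-weighted column is at most the column total. -/
theorem tsum_exp_mul_mass_le {δ : ℝ} (hδ : 0 ≤ δ) (hμ0 : ∀ y w, 0 ≤ μ y w) (hμy : ∀ w, Summable fun y => μ y w)
    (X w : Site (d + 1)) : ∑' y, Real.exp (-δ * l1 (X - y)) * μ y w ≤ ∑' y, μ y w := by
  refine (summable_exp_mul_mass hδ hμ0 hμy X w).tsum_le_tsum (fun y => ?_) (hμy w)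
  have h1 : Real.exp (-δ * l1 (X - y)) ≤ 1 := by
    rw [Real.exp_le_one_iff]; nlinarith [l1_nonneg (X - y)]
  exact mul_le_of_le_one_left (hμ0 y w) h1

/-- [folklore] `|(K ∘ V) X w a g| ≤ |Fib d|·C·Σ'_y e^{−δ‖X−y‖₁}·μ y w` (`Decays K C δ`, `|V y w f g| ≤ μ y w`). -/
theorem abs_comp_le_mass (hK : Decays K C δ) (hδ : 0 < δ) (hμ0 : ∀ y w, 0 ≤ μ y w) (hVμ : ∀ y w f g, |V y w f g| ≤ μ y w)
    (hμy : ∀ w, Summable fun y => μ y w) (X w : Site (d + 1)) (a g : Fib d) :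
    |comp K V X w a g| ≤ (Fintype.card (Fib d) : ℝ) * (C * ∑' y, Real.exp (-δ * l1 (X - y)) * μ y w) := by
  have hC : 0 ≤ C := hK.nonneg a
  unfold ExpKernelCalculus.comp
  have hs := summable_exp_mul_mass hδ.le hμ0 hμy X w
  have hmaj := (hs.mul_left C).mul_left (Fintype.card (Fib d) : ℝ)
  have hb := tsum_of_norm_bounded hmaj.hasSum (fun y => by
    rw [Real.norm_eq_abs]
    calc |∑ f, K X y a f * V y w f g| ≤ ∑ f, |K X y a f * V y w f g| := Finset.abs_sum_le_sum_abs _ _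
      _ ≤ ∑ _f : Fib d, C * Real.exp (-δ * l1 (X - y)) * μ y w := Finset.sum_le_sum fun f _ => by
          rw [abs_mul]
          exact mul_le_mul (hK X y a f) (hVμ y w f g) (abs_nonneg _) (mul_nonneg hC (Real.exp_pos _).le)
      _ = (Fintype.card (Fib d) : ℝ) * (C * (Real.exp (-δ * l1 (X - y)) * μ y w)) := by
          rw [Finset.sum_const, Finset.card_univ, nsmul_eq_mul]; ring)
  rw [Real.norm_eq_abs] at hb
  refine hb.trans (le_of_eq ?_)
  rw [tsum_mul_left, tsum_mul_left]

/-- [folklore] `w ↦ (Σ'_y e^{−δ‖X−y‖₁} μ y w)·e^{−δ‖w−Z‖₁}` is summable (comparison with the column totals). -/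
theorem summable_mass_col_exp {δ : ℝ} (hδ : 0 ≤ δ) (hμ0 : ∀ y w, 0 ≤ μ y w) (hμy : ∀ w, Summable fun y => μ y w)
    (hμw : Summable fun w => ∑' y, μ y w) (X Z : Site (d + 1)) :
    Summable fun w => (∑' y, Real.exp (-δ * l1 (X - y)) * μ y w) * Real.exp (-δ * l1 (w - Z)) := by
  refine Summable.of_nonneg_of_le (fun w => mul_nonneg (tsum_nonneg fun y => mul_nonneg (Real.exp_pos _).le (hμ0 y w)) (Real.exp_pos _).le)
    (fun w => ?_) hμw
  have h1 : Real.exp (-δ * l1 (w - Z)) ≤ 1 := by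
    rw [Real.exp_le_one_iff]; nlinarith [l1_nonneg (w - Z)]
  calc (∑' y, Real.exp (-δ * l1 (X - y)) * μ y w) * Real.exp (-δ * l1 (w - Z))
      ≤ (∑' y, Real.exp (-δ * l1 (X - y)) * μ y w) * 1 :=
        mul_le_mul_of_nonneg_left h1 (tsum_nonneg fun y => mul_nonneg (Real.exp_pos _).le (hμ0 y w))
    _ ≤ ∑' y, μ y w := by rw [mul_one]; exact tsum_exp_mul_mass_le hδ hμ0 hμy X w

/-- [folklore] One output entry: `|(K ∘ V ∘ K) X Z a b| ≤ |Fib d|²·C²·Σ'_w (Σ'_y e^{−δ‖X−y‖₁} μ y w)·e^{−δ‖w−Z‖₁}`. -/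
theorem abs_sandwich_le_mass (hK : Decays K C δ) (hδ : 0 < δ) (hμ0 : ∀ y w, 0 ≤ μ y w) (hVμ : ∀ y w f g, |V y w f g| ≤ μ y w)
    (hμy : ∀ w, Summable fun y => μ y w) (hμw : Summable fun w => ∑' y, μ y w) (X Z : Site (d + 1)) (a b : Fib d) :
    |comp (comp K V) K X Z a b|
      ≤ (Fintype.card (Fib d) : ℝ) * ((Fintype.card (Fib d) : ℝ) * (C * C))
          * ∑' w, (∑' y, Real.exp (-δ * l1 (X - y)) * μ y w) * Real.exp (-δ * l1 (w - Z)) := by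
  have hC : 0 ≤ C := hK.nonneg a
  have hs := summable_mass_col_exp hδ.le hμ0 hμy hμw X Z
  unfold ExpKernelCalculus.comp
  have hmaj := hs.mul_left ((Fintype.card (Fib d) : ℝ) * ((Fintype.card (Fib d) : ℝ) * (C * C)))
  have hb := tsum_of_norm_bounded hmaj.hasSum (fun w => by
    rw [Real.norm_eq_abs]
    calc |∑ g, (∑' y, ∑ f, K X y a f * V y w f g) * K w Z g b|
        ≤ ∑ g, |(∑' y, ∑ f, K X y a f * V y w f g) * K w Z g b| := Finset.abs_sum_le_sum_abs _ _
      _ ≤ ∑ _g : Fib d, ((Fintype.card (Fib d) : ℝ) * (C * ∑' y, Real.exp (-δ * l1 (X - y)) * μ y w))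
            * (C * Real.exp (-δ * l1 (w - Z))) := Finset.sum_le_sum fun g _ => by
          rw [abs_mul]
          have h1 := abs_comp_le_mass hK hδ hμ0 hVμ hμy X w a g
          unfold ExpKernelCalculus.comp at h1
          exact mul_le_mul h1 (hK w Z g b) (abs_nonneg _)
            (mul_nonneg (Nat.cast_nonneg _) (mul_nonneg hC (tsum_nonneg fun y => mul_nonneg (Real.exp_pos _).le (hμ0 y w))))
      _ = (Fintype.card (Fib d) : ℝ) * ((Fintype.card (Fib d) : ℝ) * (C * C))
            * ((∑' y, Real.exp (-δ * l1 (X - y)) * μ y w) * Real.exp (-δ * l1 (w - Z))) := by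
          rw [Finset.sum_const, Finset.card_univ, nsmul_eq_mul]; ring)
  rw [Real.norm_eq_abs] at hb
  refine hb.trans (le_of_eq ?_)
  rw [tsum_mul_left]

/-! ## §2 Finite partial sums over pairs of coarse points: the ℓ¹ → ℓ¹ gain -/

/-- [folklore] One output row over finitely many dilated columns: `Σ_{z′∈Fz} |(K∘V∘K) X (N•z′) a b| ≤ |Fib d|²·C²·Z_δ·Σ'_w Σ'_y e^{−δ‖X−y‖₁} μ y w`. -/
theorem finsetSum_abs_sandwich_row_le (hK : Decays K C δ) (hδ : 0 < δ) (hN : 1 ≤ N) (hμ0 : ∀ y w, 0 ≤ μ y w)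
    (hVμ : ∀ y w f g, |V y w f g| ≤ μ y w) (hμy : ∀ w, Summable fun y => μ y w) (hμw : Summable fun w => ∑' y, μ y w)
    (X : Site (d + 1)) (Fz : Finset (Site (d + 1))) (a b : Fib d) :
    ∑ z' ∈ Fz, |comp (comp K V) K X ((N : ℤ) • z') a b|
      ≤ (Fintype.card (Fib d) : ℝ) * ((Fintype.card (Fib d) : ℝ) * (C * C)) * Zl (d + 1) δ
          * ∑' w, ∑' y, Real.exp (-δ * l1 (X - y)) * μ y w := by
  have hC : 0 ≤ C := hK.nonneg a
  have hcard : 0 ≤ (Fintype.card (Fib d) : ℝ) * ((Fintype.card (Fib d) : ℝ) * (C * C)) := by positivity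
  have hP0 : ∀ w, 0 ≤ ∑' y, Real.exp (-δ * l1 (X - y)) * μ y w := fun w => tsum_nonneg fun y => mul_nonneg (Real.exp_pos _).le (hμ0 y w)
  have hPs : Summable fun w => ∑' y, Real.exp (-δ * l1 (X - y)) * μ y w :=
    Summable.of_nonneg_of_le hP0 (fun w => tsum_exp_mul_mass_le hδ.le hμ0 hμy X w) hμw
  -- entry by entry
  have h1 : ∑ z' ∈ Fz, |comp (comp K V) K X ((N : ℤ) • z') a b|
      ≤ ∑ z' ∈ Fz, (Fintype.card (Fib d) : ℝ) * ((Fintype.card (Fib d) : ℝ) * (C * C))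
          * ∑' w, (∑' y, Real.exp (-δ * l1 (X - y)) * μ y w) * Real.exp (-δ * l1 (w - (N : ℤ) • z')) :=
    Finset.sum_le_sum fun z' _ => abs_sandwich_le_mass hK hδ hμ0 hVμ hμy hμw X _ a b
  refine h1.trans ?_
  -- the finite sum inside the series, then the dilated exponential sum is at most `Z_δ`
  rw [← Finset.mul_sum]
  have key : ∑ z' ∈ Fz, ∑' w, (∑' y, Real.exp (-δ * l1 (X - y)) * μ y w) * Real.exp (-δ * l1 (w - (N : ℤ) • z'))
      ≤ Zl (d + 1) δ * ∑' w, ∑' y, Real.exp (-δ * l1 (X - y)) * μ y w := by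
    rw [← Summable.tsum_finsetSum (fun z' _ => summable_mass_col_exp hδ.le hμ0 hμy hμw X _), ← tsum_mul_left]
    refine (summable_sum fun z' _ => summable_mass_col_exp hδ.le hμ0 hμy hμw X _).tsum_le_tsum (fun w => ?_) (hPs.mul_left _)
    rw [← Finset.mul_sum, mul_comm (Zl (d + 1) δ)]
    exact mul_le_mul_of_nonneg_left (finsetSum_exp_dilate_le_Zl hδ hN w Fz) (hP0 w)
  calc (Fintype.card (Fib d) : ℝ) * ((Fintype.card (Fib d) : ℝ) * (C * C))
        * ∑ z' ∈ Fz, ∑' w, (∑' y, Real.exp (-δ * l1 (X - y)) * μ y w) * Real.exp (-δ * l1 (w - (N : ℤ) • z'))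
      ≤ (Fintype.card (Fib d) : ℝ) * ((Fintype.card (Fib d) : ℝ) * (C * C))
        * (Zl (d + 1) δ * ∑' w, ∑' y, Real.exp (-δ * l1 (X - y)) * μ y w) := mul_le_mul_of_nonneg_left key hcard
    _ = _ := by ring

/-- [folklore] `Σ_{x′∈Fx} Σ'_w Σ'_y e^{−δ‖N•x′−y‖₁} μ y w ≤ Z_δ·M₁`. -/
theorem finsetSum_tsum_exp_mul_mass_le {δ : ℝ} (hδ : 0 < δ) (hN : 1 ≤ N) (hμ0 : ∀ y w, 0 ≤ μ y w) (hμy : ∀ w, Summable fun y => μ y w)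
    (hμw : Summable fun w => ∑' y, μ y w) (Fx : Finset (Site (d + 1))) :
    ∑ x' ∈ Fx, ∑' w, ∑' y, Real.exp (-δ * l1 ((N : ℤ) • x' - y)) * μ y w ≤ Zl (d + 1) δ * ∑' w, ∑' y, μ y w := by
  have hPs : ∀ x' : Site (d + 1), Summable fun w => ∑' y, Real.exp (-δ * l1 ((N : ℤ) • x' - y)) * μ y w := fun x' =>
    Summable.of_nonneg_of_le (fun w => tsum_nonneg fun y => mul_nonneg (Real.exp_pos _).le (hμ0 y w))
      (fun w => tsum_exp_mul_mass_le hδ.le hμ0 hμy _ w) hμw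
  rw [← Summable.tsum_finsetSum (fun x' _ => hPs x'), ← tsum_mul_left]
  refine (summable_sum fun x' _ => hPs x').tsum_le_tsum (fun w => ?_) (hμw.mul_left _)
  -- inside one column: the finite sum over `x′` inside the series over `y`, then `finsetSum_exp_dilate_le_Zl`
  rw [← Summable.tsum_finsetSum (fun x' _ => summable_exp_mul_mass hδ.le hμ0 hμy _ w), ← tsum_mul_left]
  refine (summable_sum fun x' _ => summable_exp_mul_mass hδ.le hμ0 hμy _ w).tsum_le_tsum (fun y => ?_) ((hμy w).mul_left _)
  rw [← Finset.sum_mul]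
  refine mul_le_mul_of_nonneg_right ?_ (hμ0 y w)
  have e : ∀ x' : Site (d + 1), Real.exp (-δ * l1 ((N : ℤ) • x' - y)) = Real.exp (-δ * l1 (y - (N : ℤ) • x')) := fun x' => by
    rw [ExpKernelCalculus.l1_sub_symm]
  simp only [e]
  exact finsetSum_exp_dilate_le_Zl hδ hN y Fx

/-- [folklore] **THE ℓ¹ → ℓ¹ GAIN OF THE SANDWICH**: for all finite sets `Fx, Fz` of coarse points and all legs,
`Σ_{x′∈Fx} Σ_{z′∈Fz} |(K ∘ V ∘ K) (N•x′) (N•z′) a b| ≤ |Fib d|²·C²·Z_δ²·M₁` — uniformly in `Fx, Fz`: the output's total entry mass over the dilated points is at most a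
KERNEL-ONLY multiple of the input's total mass, with NO multiplicity from the refinement. -/
theorem finsetSum_abs_sandwich_le_mass (hK : Decays K C δ) (hδ : 0 < δ) (hN : 1 ≤ N) (hμ0 : ∀ y w, 0 ≤ μ y w)
    (hVμ : ∀ y w f g, |V y w f g| ≤ μ y w) (hμy : ∀ w, Summable fun y => μ y w) (hμw : Summable fun w => ∑' y, μ y w)
    (Fx Fz : Finset (Site (d + 1))) (a b : Fib d) :
    ∑ x' ∈ Fx, ∑ z' ∈ Fz, |comp (comp K V) K ((N : ℤ) • x') ((N : ℤ) • z') a b|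
      ≤ (Fintype.card (Fib d) : ℝ) * ((Fintype.card (Fib d) : ℝ) * (C * C)) * Zl (d + 1) δ * (Zl (d + 1) δ * ∑' w, ∑' y, μ y w) := by
  have hC : 0 ≤ C := hK.nonneg a
  have hcard : 0 ≤ (Fintype.card (Fib d) : ℝ) * ((Fintype.card (Fib d) : ℝ) * (C * C)) * Zl (d + 1) δ :=
    mul_nonneg (by positivity) (Zl_nonneg hδ)
  calc ∑ x' ∈ Fx, ∑ z' ∈ Fz, |comp (comp K V) K ((N : ℤ) • x') ((N : ℤ) • z') a b|
      ≤ ∑ x' ∈ Fx, (Fintype.card (Fib d) : ℝ) * ((Fintype.card (Fib d) : ℝ) * (C * C)) * Zl (d + 1) δ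
          * ∑' w, ∑' y, Real.exp (-δ * l1 ((N : ℤ) • x' - y)) * μ y w :=
        Finset.sum_le_sum fun x' _ => finsetSum_abs_sandwich_row_le hK hδ hN hμ0 hVμ hμy hμw _ Fz a b
    _ = (Fintype.card (Fib d) : ℝ) * ((Fintype.card (Fib d) : ℝ) * (C * C)) * Zl (d + 1) δ
          * ∑ x' ∈ Fx, ∑' w, ∑' y, Real.exp (-δ * l1 ((N : ℤ) • x' - y)) * μ y w := by rw [Finset.mul_sum]
    _ ≤ (Fintype.card (Fib d) : ℝ) * ((Fintype.card (Fib d) : ℝ) * (C * C)) * Zl (d + 1) δ * (Zl (d + 1) δ * ∑' w, ∑' y, μ y w) :=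
        mul_le_mul_of_nonneg_left (finsetSum_tsum_exp_mul_mass_le hδ hN hμ0 hμy hμw Fx) hcard

/-- [folklore] **THE ℓ¹ → ℓ¹ GAIN OF THE FLUX MAP** `c • mmRead N (K ∘ V ∘ K)` at every pair of leg indices: `Σ_{x′∈Fx} Σ_{z′∈Fz} |(c • mmRead N (K∘V∘K)) x′ z′ a b|
≤ |c|·|Fib d|²·C²·Z_δ²·M₁` (the `ff` block is the sandwich at the dilated points; the other blocks of `mmRead` are `0`). -/
theorem finsetSum_abs_smul_mmRead_sandwich_le_mass (hK : Decays K C δ) (hδ : 0 < δ) (hN : 1 ≤ N) (hμ0 : ∀ y w, 0 ≤ μ y w)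
    (hVμ : ∀ y w f g, |V y w f g| ≤ μ y w) (hμy : ∀ w, Summable fun y => μ y w) (hμw : Summable fun w => ∑' y, μ y w)
    (c : ℝ) (Fx Fz : Finset (Site (d + 1))) (a b : Fib d) :
    ∑ x' ∈ Fx, ∑ z' ∈ Fz, |(c • mmRead N (comp (comp K V) K)) x' z' a b|
      ≤ |c| * ((Fintype.card (Fib d) : ℝ) * ((Fintype.card (Fib d) : ℝ) * (C * C)) * Zl (d + 1) δ * (Zl (d + 1) δ * ∑' w, ∑' y, μ y w)) := by
  have hC : 0 ≤ C := hK.nonneg (Sum.inl 0)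
  have htot : 0 ≤ (Fintype.card (Fib d) : ℝ) * ((Fintype.card (Fib d) : ℝ) * (C * C)) * Zl (d + 1) δ * (Zl (d + 1) δ * ∑' w, ∑' y, μ y w) :=
    mul_nonneg (mul_nonneg (by positivity) (Zl_nonneg hδ)) (mul_nonneg (Zl_nonneg hδ) (tsum_nonneg fun w => tsum_nonneg fun y => hμ0 y w))
  have e : ∀ x' z', |(c • mmRead N (comp (comp K V) K)) x' z' a b| = |c| * |mmRead N (comp (comp K V) K) x' z' a b| := fun x' z' => by
    simp only [Pi.smul_apply, smul_eq_mul, abs_mul]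
  simp only [e, ← Finset.mul_sum]
  refine mul_le_mul_of_nonneg_left ?_ (abs_nonneg c)
  rcases a with α | m
  · rcases b with β | m'
    · simp only [mmRead_inl_inl]
      exact finsetSum_abs_sandwich_le_mass hK hδ hN hμ0 hVμ hμy hμw Fx Fz (Sum.inr α) (Sum.inr β)
    · have h0 : ∀ x' z' : Site (d + 1), |mmRead N (comp (comp K V) K) x' z' (Sum.inl α) (Sum.inr m')| = 0 := fun x' z' => by
        simp [mmRead]
      simp only [h0, Finset.sum_const_zero]
      exact htot
  · have h0 : ∀ x' z' : Site (d + 1), |mmRead N (comp (comp K V) K) x' z' (Sum.inr m) b| = 0 := fun x' z' => by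
      cases b <;> simp [mmRead]
    simp only [h0, Finset.sum_const_zero]
    exact htot

end Mass

/-! ## §3 The one-push flux recursion in total-mass currency -/

section Flux

variable {K : MKer (d + 1) (Fib d)} {C δ : ℝ} {S : Fin (d + 1) → (Fin (d + 1) → ℤ) → MKer (d + 1) (Fib d)} {B : ℝ} {cH : ℝ}
  {μ : Site (d + 1) → Site (d + 1) → ℝ}

/-- [folklore] **THE FLUX RECURSION, TOTAL MASS**: for a decaying `K` (`δ > 0`), `N ≥ 1`, bounded letter `S`, (hH) with `c_H`, any finite `T`: if the input letter's flux
through the refinement `U_N(T)` is dominated entrywise by a mass function `μ` (summable columns, summable column totals, total mass `M₁ = Σ'_w Σ'_y μ y w`), then for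
all finite `Fx, Fz` of coarse points and legs `a b`, `Σ_{x′∈Fx} Σ_{z′∈Fz} |(Σ_{Y∈T} divV (e3OfK N K S) Y) x′ z′ a b| ≤ |c_H|·|Fib d|²·C²·Z_δ²·M₁` — the per-level factor
in ℓ¹ currency is the bare kernel-only scalar, each fine bond of the input counted once (PART 1's identity ⨾ §2). -/
theorem finsetSum_abs_regionSum_divV_e3OfK_le_mass (hK : Decays K C δ) (hδ : 0 < δ) (hN : 1 ≤ N) (hS : ∀ κ u x z a b, |S κ u x z a b| ≤ B)
    (hH : ∀ (y : Fin (d + 1) → ℤ) (κ' : Fin (d + 1)) (u : Fin (d + 1) → ℤ),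
      ∑ μ', (colH K N μ' (y - unitVec μ') κ' u - colH K N μ' y κ' u) = cH * gaugeWt N y κ' u)
    (T : Finset (Site (d + 1))) (hμ0 : ∀ y w, 0 ≤ μ y w)
    (hVμ : ∀ y w f g, |(∑ u ∈ T.biUnion (fun Y => (box (d + 1) N).image (fun v => (N : ℤ) • Y + toSite v)), divV S u) y w f g| ≤ μ y w)
    (hμy : ∀ w, Summable fun y => μ y w) (hμw : Summable fun w => ∑' y, μ y w)
    (Fx Fz : Finset (Site (d + 1))) (a b : Fib d) :
    ∑ x' ∈ Fx, ∑ z' ∈ Fz, |(∑ Y ∈ T, divV (e3OfK N K S) Y) x' z' a b|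
      ≤ |cH| * ((Fintype.card (Fib d) : ℝ) * ((Fintype.card (Fib d) : ℝ) * (C * C)) * Zl (d + 1) δ * (Zl (d + 1) δ * ∑' w, ∑' y, μ y w)) := by
  rw [regionSum_divV_e3OfK hK hδ hN hS hH T, ← neg_smul]
  have h := finsetSum_abs_smul_mmRead_sandwich_le_mass hK hδ hN hμ0 hVμ hμy hμw (-cH) Fx Fz a b
  rw [abs_neg] at h
  exact h

end Flux


end Summit.QuantumFields.BalabanUV.Beta.GAN24.BlockFluxMass

end
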